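import Summits.Schanuel.Schanuel.Theorems.RootDecomp1KPiScale01

/-!
# RootDecomp1KPiScale — lens 6, generation 20 «NESTERENKO-MEASURED SCALE π» (frame G20: lane T = the hypothesis-free DISCHARGE of the strong measure (31) at ω̄(e^{−2π}) from the tree-proved Nesterenko Ch. 3 Thm 5.1 / Prop 4.11 / Prop 4.8 ⇒ `LogPowMeasure ![π, e^π]`; lane F = K-R27 (F₊) cells on the π-lines for every log-hyper-Liouville ratio) — continuation (RootDecomp1KPiScale02): §5 `LogPowMeasure` (k = 28) for θ₃, θ₂ and ![π, e^π], hypothesis-free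

(lens-6 g20 `PiScale.lean` [HOME/decomp-schanuel-lens-6/g20/ sha256 87044252…, 707 l; NODE L1983 / REQUEST L1984; critic VERDICT L1986 (THEOREM ×1 + K-R27 (F₊) CELL ×1, port GO)]; port by census-1 gen 17 as
`RootDecomp1KPiScale01`–`03` — see the PORT NOTE of part 01; `--supports stmt-Schanuel-33364`; rung 0.)
-/

noncomputable section

open Complex IntermediateField
open MvPolynomial (aeval rename X C)
open Literature.NumberTheory.Transcendental
open Literature.NumberTheory.Transcendental.Nesterenko
open Literature.Barriers.Schanuel
open Summit.Schanuel.Schanuel.Theorems.RootDecomp1KHyper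
open Summit.Schanuel.Schanuel.Theorems.RootDecomp1KHyper.HyperCell
open Summit.Schanuel.Schanuel.Theorems.RootDecomp1KGeneric
open Summit.Schanuel.Schanuel.Theorems.RootDecomp1KRelLiouvilleCell
open Summit.Schanuel.Schanuel.Theorems.RootDecomp1KDarkLogSq
open Summit.Schanuel.Schanuel.Theorems.RootDecomp1KHyper.HyperCell.LatCell.Bilog (mvlen_rename)

namespace Summit.Schanuel.Schanuel.Theorems.RootDecomp1KPiScale

/-! ## §5  The tree class `LogPowMeasure` (k = 28) for `θ₃` and `θ₂` — hypothesis-free -/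

/-- A numeric threshold lemma (`3 ≤ …`). -/
private theorem three_le_of (d : ℕ) {L : ℝ} (hL : 0 ≤ Real.log L) : 3 ≤ ((d : ℝ) + 3) * (1 + Real.log L) := by
  have hd : (0 : ℝ) ≤ d := Nat.cast_nonneg d
  nlinarith

/-- **`LogPowMeasure (e^{−2π}, 3/π, 3Γ(1/4)⁸/(2π)⁶)`** (tree class `RootDecomp1KRelLiouvilleCell.LogPowMeasure`,
`k = 28`, `C_d = c (d + 3)²⁸`), hypothesis-free. -/
theorem logPowMeasure_theta3 : LogPowMeasure θ3 := by
  obtain ⟨c, hc, hM⟩ := measure31_theta3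
  intro d
  refine ⟨c * ((d : ℝ) + 3) ^ 28, 28, by positivity, fun P hP hdeg => ?_⟩
  obtain ⟨L, hL⟩ : ∃ L : ℝ, L = ((mvlen P : ℤ) : ℝ) := ⟨_, rfl⟩
  have hL1 : 1 ≤ L := by rw [hL]; exact_mod_cast one_le_mvlen hP
  have hlogL : 0 ≤ Real.log L := Real.log_nonneg hL1
  have hd0 : (0 : ℝ) ≤ d := Nat.cast_nonneg d
  obtain ⟨T, hT⟩ : ∃ T : ℝ, T = ((d : ℝ) + 3) * (1 + Real.log L) := ⟨_, rfl⟩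
  have hT3 : 3 ≤ T := by rw [hT]; exact three_le_of d hlogL
  have hT1 : 1 ≤ T := by linarith
  have hHL : Real.log (mvPolyHeight P : ℝ) ≤ Real.log L := by
    have h1 : ((mvPolyHeight P : ℕ) : ℝ) ≤ L := by
      have h := natAbs_coeff_sup_le_mvlen P
      rw [← hL] at h; push_cast at h; exact h
    exact Real.log_le_log (by exact_mod_cast PhilipponMain.one_le_mvPolyHeight hP) h1
  have hmax : max ((P.totalDegree : ℝ) + Real.log (mvPolyHeight P)) (Real.exp 1) ≤ T := by
    refine max_le ?_ ?_
    · have hdeg' : (P.totalDegree : ℝ) ≤ d := by exact_mod_cast hdeg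
      rw [hT]; nlinarith
    · have := Real.exp_one_lt_d9; norm_num at this; linarith
  have h := hM P hP T hmax
  rw [← hL]
  refine le_trans ?_ h
  rw [Real.exp_le_exp, neg_le_neg_iff]
  have hlogT : Real.log T ≤ T := (Real.log_le_sub_one_of_pos (by linarith)).trans (by linarith)
  have hlogT0 : 0 ≤ Real.log T := Real.log_nonneg hT1
  have h1 : Real.log T ^ 24 ≤ T ^ 24 := pow_le_pow_left₀ hlogT0 hlogT 24
  have h2 : T ^ 4 * Real.log T ^ 24 ≤ T ^ 28 := by
    calc T ^ 4 * Real.log T ^ 24 ≤ T ^ 4 * T ^ 24 := mul_le_mul_of_nonneg_left h1 (by positivity)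
      _ = T ^ 28 := by ring
  have h3 : T ^ 28 = ((d : ℝ) + 3) ^ 28 * (1 + Real.log L) ^ 28 := by rw [hT, mul_pow]
  calc c * T ^ 4 * Real.log T ^ 24 = c * (T ^ 4 * Real.log T ^ 24) := by ring
    _ ≤ c * T ^ 28 := mul_le_mul_of_nonneg_left h2 hc.le
    _ = c * ((d : ℝ) + 3) ^ 28 * (1 + Real.log L) ^ 28 := by rw [h3]; ring

/-- **`LogPowMeasure (e^{−2π}, 3/π)`** (the shadow of `θ₃` on the first two coordinates), hypothesis-free. -/
theorem logPowMeasure_theta2 : LogPowMeasure θ2 := by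
  intro d
  obtain ⟨C, k, hC, hM⟩ := logPowMeasure_theta3 d
  refine ⟨C, k, hC, fun P hP hdeg => ?_⟩
  have hinj : Function.Injective (Fin.castSucc : Fin 2 → Fin 3) := Fin.castSucc_injective 2
  have hP' : rename Fin.castSucc P ≠ 0 := fun h =>
    hP (MvPolynomial.rename_injective _ hinj (by rw [map_zero]; exact h))
  have hdeg' : (rename (Fin.castSucc : Fin 2 → Fin 3) P).totalDegree ≤ d :=
    le_trans (MvPolynomial.totalDegree_rename_le _ _) hdeg
  have h := hM _ hP' hdeg'
  rw [mvlen_rename _ hinj, MvPolynomial.aeval_rename] at h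
  rw [θ2_eq]; exact h

end Summit.Schanuel.Schanuel.Theorems.RootDecomp1KPiScale

end
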